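import Summits.KontsevichZagierPeriods.KontsevichZagierPeriods.Theorems.IsogenyCertificatesXMapKernelStubCMClassAux
import Summits.KontsevichZagierPeriods.KontsevichZagierPeriods.Theorems.IsogenyCertificatesXMapKernelStubRadicalIndependence
import Summits.KontsevichZagierPeriods.KontsevichZagierPeriods.Theorems.IsogenyCertificatesXMapKernelStubMultiplierRigidity
import Literature.NumberTheory.Transcendental.ManyCurvePeriodsIsotypicProofs

/-!
# `XMapKernel`, line `derived-datum-quasi-periods` — stub **H2-CM** (`stub_cmClassEta`),
# auxiliary file: Masser's Theorem III in two-term form, and the radical structure of a CM class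

Support file for the crux `IsogenyCertificates.XMapKernel` (stmt-KontsevichZagierPeriods-10663),
line `derived-datum-quasi-periods`, stub `stub_cmClassEta` (H2-CM: class independence WITH
quasi-periods inside one isogeny class of CM lattices). This auxiliary file carries four
self-contained ingredients; its registered main theorem is `radical_indep_finset_pow`.

1. `indep_ω₁_η₁` — **Masser's Theorem III, two-term form**: for a lattice `Λ₀` with rational
   invariants and complex multiplication, a relation `Xω₁ + Yη₁ = 0` with algebraic `X, Y` is
   trivial (sub-family of `1, 2πi, ω₁, η₁`, `masser_ellipticPeriods_cm_holds`).
2. `exists_nat_mul_eq_comb` — if `τΛ ⊆ Λ` (`τ ∉ ℝ`) and `u ∈ Λ ∩ ℝ`, `u ≠ 0`, then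
   `DΛ ⊆ ℤu + ℤτu` for some integer `D ≥ 1` (`u, τu` are `ℝ`-independent lattice vectors,
   `HuberWustholzSplitting.exists_nat_mul_mem_of_le`).
3. `cm_package` — **the radical structure of one member of a CM class** (steps 1–2 of the landed
   `ω`-only proof `CMClass.stub_cmClass`, isolated): `Λ₀` with rational invariants, CM multiplier
   `τ` (`τ² = pτ + q`), a real lattice vector `u > 0`; `Λ'` real with rational invariants and a
   multiplier `αΛ₀ ⊆ Λ'`, `α ≠ 0`. Then `NΛ' ⊆ αΛ₀` for some `N ≥ 1`, so `Nτ` is a CM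
   multiplier of `Λ'`, `Λ' ⊆ (ℚ + ℚτ)·Ω₀(Λ')`, and `ρ = Ω₀(Λ')/u` has `ρ^d ∈ ℚ` for some `d ≥ 1`:
   every `Aut(ℂ)`-conjugate of `ρ` lies in `(ℚ + ℚτ)ρ` by the rigidity of multipliers
   (`MultiplierRigidity.stub_multiplierRigidity`, R-b0) and the norm argument
   `CMClass.stub_cmClass_powRational` applies.
4. `radical_indep_finset_pow` — R-b4 (`RadicalIndependence.stub_radicalIndependence`,
   Besicovitch–Mordell) re-indexed along a finset.

No definitions, no named facts.

References: D. Masser, *Elliptic Functions and Transcendence*, LNM 437 (1975), Ch. III Thm. III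
and Lemma 3.1; D. A. Cox, *Primes of the form x² + ny²* (2013), §10.C; L. J. Mordell, Pacific J.
Math. 3 (1953), Thm. 1.
-/

noncomputable section

namespace Summit.KontsevichZagierPeriods.IsogenyCertificates.XMapKernelStubs.CMClassEta

open scoped BigOperators
open Complex Literature.NumberTheory.Transcendental
open Summit.KontsevichZagierPeriods.IsogenyCertificates.XMapKernelStubs.CMClass

/-- **Masser's Theorem III, two-term form.** For a lattice with rational invariants and complex
multiplication, `ω₁` and `η₁` are linearly independent over `ℚ̄`: a relation `Xω₁ + Yη₁ = 0`
with algebraic `X, Y` is the relation `0·1 + 0·2πi + Xω₁ + Yη₁ = 0` among Masser's four numbers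
(`masser_ellipticPeriods_cm_holds`). [cite: Masser1975, Ch. III Thm. III] -/
theorem indep_ω₁_η₁ {L₀ : PeriodPair} (h₂ : ∃ r : ℚ, (r : ℂ) = L₀.g₂)
    (h₃ : ∃ r : ℚ, (r : ℂ) = L₀.g₃) (hCM : L₀.HasCM) {X Y : ℂ} (hX : IsAlgebraic ℚ X)
    (hY : IsAlgebraic ℚ Y) (h : X * L₀.ω₁ + Y * L₀.η₁ = 0) : X = 0 ∧ Y = 0 := by
  obtain ⟨r₂, hr₂⟩ := h₂
  obtain ⟨r₃, hr₃⟩ := h₃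
  have hM := masser_ellipticPeriods_cm_holds L₀ (by rw [← hr₂]; exact isAlgebraic_algebraMap r₂)
    (by rw [← hr₃]; exact isAlgebraic_algebraMap r₃) hCM
  have hβ : ∀ i, IsAlgebraic ℚ ((![0, 0, X, Y] : Fin 4 → ℂ) i) := by
    intro i
    fin_cases i
    · exact isAlgebraic_zero
    · exact isAlgebraic_zero
    · exact hX
    · exact hY
  have hs : ∑ i, (![0, 0, X, Y] : Fin 4 → ℂ) i * ![1, 2 * Real.pi * I, L₀.ω₁, L₀.η₁] i = 0 := by
    rw [Fin.sum_univ_four]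
    show 0 * 1 + 0 * (2 * Real.pi * I) + X * L₀.ω₁ + Y * L₀.η₁ = 0
    rw [zero_mul, zero_mul, zero_add, zero_add]
    exact h
  have h4 := hM _ hβ hs
  exact ⟨h4 2, h4 3⟩

/-- **Bounded denominators in a CM lattice.** If `τΛ ⊆ Λ` with `τ ∉ ℝ` and `u ∈ Λ` is a
non-zero real lattice vector, then `DΛ ⊆ ℤu + ℤτu` for some integer `D ≥ 1`: `u, τu` are
`ℝ`-independent lattice vectors spanning a sub-lattice of finite index
(`HuberWustholzSplitting.exists_nat_mul_mem_of_le`). [folklore] -/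
theorem exists_nat_mul_eq_comb {L : PeriodPair} {τ : ℂ} (hτ : τ.im ≠ 0)
    (hτL : ∀ l ∈ L.lattice, τ * l ∈ L.lattice) {u : ℝ} (hu : u ≠ 0)
    (huL : (u : ℂ) ∈ L.lattice) :
    ∃ D : ℕ, D ≠ 0 ∧ ∀ l ∈ L.lattice, ∃ m n : ℤ, (D : ℂ) * l = m * u + n * (τ * u) := by
  let P : PeriodPair := ⟨u, τ * u, linearIndependent_pair hτ hu⟩
  have hle : P.lattice ≤ L.lattice := by
    refine Submodule.span_le.2 ?_
    rintro x (rfl | rfl)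
    · exact huL
    · exact hτL _ huL
  obtain ⟨D, hD, hDL⟩ := HuberWustholzSplitting.exists_nat_mul_mem_of_le hle
  refine ⟨D, hD, fun l hl => ?_⟩
  obtain ⟨m, n, hmn⟩ := PeriodPair.mem_lattice.1 (hDL l hl)
  exact ⟨m, n, hmn.symm⟩

/-- **The radical structure of one member of a CM class.** Let `Λ₀` have rational invariants,
a CM multiplier `τΛ₀ ⊆ Λ₀` (`τ ∉ ℝ`, `τ² = pτ + q`) and a real lattice vector `u > 0`; let `Λ'` be
a real lattice with rational invariants receiving a multiplier `αΛ₀ ⊆ Λ'`, `α ≠ 0`. Then for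
some integer `N ≥ 1`: `Nτ` is a multiplier of `Λ'` (`NΛ' ⊆ αΛ₀`,
`HuberWustholzSplitting.exists_nat_mul_mem_of_le`), `Λ' ⊆ (ℚ + ℚτ)·Ω₀(Λ')`
(`CMClass.lattice_subset_qtau_mul`), and `ρ = Ω₀(Λ')/u` satisfies `ρ^d ∈ ℚ` for some `d ≥ 1`:
`ρ = κα` with `κ ∈ ℚ + ℚτ`, every conjugate `σ(α)` is again a multiplier `Λ₀ → Λ'` (R-b0,
`MultiplierRigidity.stub_multiplierRigidity`), so `σ(ρ) ∈ (ℚ + ℚτ)ρ`, and the norm argument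
`CMClass.stub_cmClass_powRational` concludes. [cite: Cox2013, Thm. 10.14 and §10.C] -/
theorem cm_package {L₀ L' : PeriodPair} {τ : ℂ} {p₀ q₀ : ℤ} {u : ℝ} {α : ℂ}
    (hg₂ : ∃ r : ℚ, (r : ℂ) = L₀.g₂) (hg₃ : ∃ r : ℚ, (r : ℂ) = L₀.g₃)
    (hg₂' : ∃ r : ℚ, (r : ℂ) = L'.g₂) (hg₃' : ∃ r : ℚ, (r : ℂ) = L'.g₃)
    (hτ : τ.im ≠ 0) (hτL : ∀ l ∈ L₀.lattice, τ * l ∈ L₀.lattice)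
    (hquad : τ ^ 2 = (p₀ : ℂ) * τ + (q₀ : ℂ)) (hu : 0 < u) (huL : (u : ℂ) ∈ L₀.lattice)
    (hreal' : L'.IsReal) (hα : α ≠ 0) (hαL : ∀ l ∈ L₀.lattice, α * l ∈ L'.lattice) :
    ∃ N : ℕ, N ≠ 0 ∧ (∀ y ∈ L'.lattice, (N : ℂ) * τ * y ∈ L'.lattice) ∧
      (∀ y ∈ L'.lattice, ∃ a b : ℚ, y = ((a : ℂ) + b * τ) * L'.minRealPeriod) ∧
      ∃ d : ℕ, 0 < d ∧ ∃ r : ℚ, (L'.minRealPeriod / u) ^ d = (r : ℝ) := by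
  classical
  -- (0) algebraicity of the invariants, rigidity and algebraicity of `α`
  have h₀alg : IsAlgebraic ℚ L₀.g₂ ∧ IsAlgebraic ℚ L₀.g₃ := by
    obtain ⟨r₂, hr₂⟩ := hg₂
    obtain ⟨r₃, hr₃⟩ := hg₃
    exact ⟨by rw [← hr₂]; exact isAlgebraic_algebraMap r₂,
      by rw [← hr₃]; exact isAlgebraic_algebraMap r₃⟩
  have h'alg : IsAlgebraic ℚ L'.g₂ ∧ IsAlgebraic ℚ L'.g₃ := by
    obtain ⟨r₂, hr₂⟩ := hg₂'
    obtain ⟨r₃, hr₃⟩ := hg₃'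
    exact ⟨by rw [← hr₂]; exact isAlgebraic_algebraMap r₂,
      by rw [← hr₃]; exact isAlgebraic_algebraMap r₃⟩
  have hRig : ∀ σ : ℂ ≃+* ℂ, ∀ l ∈ L₀.lattice, σ α * l ∈ L'.lattice := fun σ =>
    MultiplierRigidity.stub_multiplierRigidity L₀ L' α σ hg₂ hg₃ hg₂' hg₃' hα hαL
  have hαalg : IsAlgebraic ℚ α :=
    HuberWustholzSplitting.isAlgebraic_of_mul_mem_lattice h₀alg.1 h₀alg.2 h'alg.1 h'alg.2 hα hαL
  have hw : 0 < L'.minRealPeriod := hreal'.minRealPeriod_pos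
  have hwL : ((L'.minRealPeriod : ℝ) : ℂ) ∈ L'.lattice := hreal'.minRealPeriod_mem_lattice
  have huc : (u : ℂ) ≠ 0 := by exact_mod_cast hu.ne'
  have hΛ₀ := lattice_subset_qtau_mul hτ hτL hu.ne' huL
  -- (1) `NΛ' ⊆ αΛ₀`
  obtain ⟨N, hN0, hNL⟩ : ∃ N : ℕ, N ≠ 0 ∧
      ∀ y ∈ L'.lattice, ∃ l ∈ L₀.lattice, (N : ℂ) * y = α * l := by
    have hαi : α⁻¹ ≠ 0 := inv_ne_zero hα
    have hle : L₀.lattice ≤ (L'.mulLeft α⁻¹ hαi).lattice := fun l hl =>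
      PeriodPair.mem_mulLeft_lattice.2 (by rw [inv_inv]; exact hαL l hl)
    obtain ⟨N, hN, hNM⟩ := HuberWustholzSplitting.exists_nat_mul_mem_of_le hle
    refine ⟨N, hN, fun y hy => ⟨α⁻¹ * ((N : ℂ) * y), ?_, ?_⟩⟩
    · have h1 := hNM (α⁻¹ * y) (PeriodPair.mem_mulLeft_lattice.2
        (by rw [inv_inv, ← mul_assoc, mul_inv_cancel₀ hα, one_mul]; exact hy))
      have e : α⁻¹ * ((N : ℂ) * y) = (N : ℂ) * (α⁻¹ * y) := by ring
      rw [e]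
      exact h1
    · rw [← mul_assoc, mul_inv_cancel₀ hα, one_mul]
  -- (2) `Nτ` is a CM multiplier of `Λ'`, so `Λ' ⊆ (ℚ + ℚτ)·Ω₀(Λ')`
  have hτ' : ∀ y ∈ L'.lattice, (N : ℂ) * τ * y ∈ L'.lattice := by
    intro y hy
    obtain ⟨l, hl, hNy⟩ := hNL y hy
    have e : (N : ℂ) * τ * y = α * (τ * l) := by
      calc (N : ℂ) * τ * y = τ * ((N : ℂ) * y) := by ring
        _ = α * (τ * l) := by rw [hNy]; ring
    rw [e]
    exact hαL _ (hτL l hl)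
  have hΛ' : ∀ y ∈ L'.lattice, ∃ a b : ℚ, y = ((a : ℂ) + b * τ) * L'.minRealPeriod := by
    intro y hy
    have hτ'' : ((N : ℂ) * τ).im ≠ 0 := by
      rw [show ((N : ℂ) * τ).im = (N : ℝ) * τ.im by simp]
      exact mul_ne_zero (by exact_mod_cast hN0) hτ
    obtain ⟨a, b, hab⟩ := lattice_subset_qtau_mul hτ'' (fun y hy => hτ' y hy) hw.ne' hwL y hy
    exact ⟨a, b * N, by rw [hab]; push_cast; ring⟩
  -- (3) `ρ = Ω₀(Λ')/u = κα` with `κ ∈ ℚ + ℚτ`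
  obtain ⟨ρ, hρ⟩ : ∃ ρ : ℝ, ρ = L'.minRealPeriod / u := ⟨_, rfl⟩
  have hρpos : 0 < ρ := by rw [hρ]; exact div_pos hw hu
  have hρw : ((L'.minRealPeriod : ℝ) : ℂ) = ρ * u := by
    rw [hρ]; push_cast; field_simp
  have hρκ : ∃ a b : ℚ, (ρ : ℂ) = ((a : ℂ) + b * τ) * α := by
    obtain ⟨l, hl, hNw⟩ := hNL _ hwL
    obtain ⟨a, b, hab⟩ := hΛ₀ l hl
    have hNc : (N : ℂ) ≠ 0 := by exact_mod_cast hN0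
    refine ⟨a / N, b / N, ?_⟩
    rw [hab, hρw] at hNw
    have h1 : (N : ℂ) * ρ = α * ((a : ℂ) + b * τ) := by
      apply mul_right_cancel₀ huc
      linear_combination hNw
    push_cast
    field_simp
    linear_combination h1
  -- (4) rigidity: every conjugate of `ρ` lies in `(ℚ + ℚτ)ρ`
  have hconj : ∀ σ : ℂ ≃+* ℂ, ∃ a b : ℚ, σ (ρ : ℂ) = ((a : ℂ) + b * τ) * (ρ : ℂ) := by
    intro σ
    obtain ⟨a₁, b₁, h₁⟩ := hΛ' _ (hRig σ _ huL)
    obtain ⟨a₂, b₂, h₂⟩ := hρκ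
    obtain ⟨a₃, b₃, h₃⟩ := ringEquiv_apply_qtau hquad σ a₂ b₂
    obtain ⟨a₄, b₄, h₄⟩ := qtau_mul hquad a₃ b₃ a₁ b₁
    refine ⟨a₄, b₄, ?_⟩
    have e1 : σ (ρ : ℂ) = ((a₃ : ℂ) + b₃ * τ) * σ α := by rw [h₂, map_mul, h₃]
    rw [hρw] at h₁
    have e2 : σ α = ((a₁ : ℂ) + b₁ * τ) * ρ :=
      mul_right_cancel₀ huc (h₁.trans (mul_assoc _ _ _).symm)
    rw [e1, e2]
    linear_combination (ρ : ℂ) * h₄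
  -- (5) the norm argument
  have hρalg : IsAlgebraic ℚ (ρ : ℂ) := by
    obtain ⟨a, b, hab⟩ := hρκ
    rw [hab]
    exact ((isAlgebraic_algebraMap a).add ((isAlgebraic_algebraMap b).mul
      (isAlgebraic_tau hquad))).mul hαalg
  obtain ⟨d, hd, r, hr⟩ :=
    stub_cmClass_powRational τ p₀ q₀ hτ hquad ρ hρpos.ne' hρalg hconj
  exact ⟨N, hN0, hτ', hΛ', d, hd, r, by rw [← hρ]; exact hr⟩

/-- **Linear independence of radicals on a finset** (the landed stub R-b4
`RadicalIndependence.stub_radicalIndependence`, Besicovitch/Mordell, re-indexed along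
`T ≃ Fin |T|`, for a general exponent `m ≥ 1`): positive reals `yⱼ` (`j ∈ T`) with rational
`m`-th powers and pairwise irrational ratios are `ℚ`-linearly independent. This is the auxiliary
file's registered main theorem. [cite: Mordell1953, Theorem 1] -/
theorem radical_indep_finset_pow : ∀ (m : ℕ), 0 < m → ∀ (k : ℕ) (T : Finset (Fin k)) (y : Fin k → ℝ) (c : Fin k → ℚ), (∀ j ∈ T, 0 < y j) → (∀ j ∈ T, ∃ a : ℚ, y j ^ m = (a : ℝ)) → (∀ j ∈ T, ∀ j' ∈ T, j ≠ j' → ¬ ∃ r : ℚ, y j = (r : ℝ) * y j') → ∑ j ∈ T, (c j : ℝ) * y j = 0 → ∀ j ∈ T, c j = 0 := by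
  intro m hm k T y c hpos hpow hirr hsum
  classical
  intro j hj
  set eT := T.equivFin with heT
  have key := RadicalIndependence.stub_radicalIndependence m hm T.card
    (fun i => y (eT.symm i)) (fun i => c (eT.symm i))
    (fun i => hpos _ (eT.symm i).2) (fun i => hpow _ (eT.symm i).2)
    (fun i i' hii' => hirr _ (eT.symm i).2 _ (eT.symm i').2
      (fun h => hii' (eT.symm.injective (Subtype.ext h))))
    (by
      calc ∑ i, ((c (eT.symm i) : ℚ) : ℝ) * y (eT.symm i)
          = ∑ z : {z // z ∈ T}, ((c z : ℚ) : ℝ) * y z :=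
            eT.symm.sum_comp (fun z : {z // z ∈ T} => ((c z : ℚ) : ℝ) * y z)
        _ = ∑ z ∈ T, ((c z : ℚ) : ℝ) * y z := Finset.sum_coe_sort T (fun z => ((c z : ℚ) : ℝ) * y z)
        _ = 0 := hsum)
  have hcj := key (eT ⟨j, hj⟩)
  simp only [Equiv.symm_apply_apply] at hcj
  exact hcj

end Summit.KontsevichZagierPeriods.IsogenyCertificates.XMapKernelStubs.CMClassEta

end
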